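import Mathlib.NumberTheory.EllipticDivisibilitySequence
import Mathlib.Data.ZMod.Basic
import Mathlib.Algebra.BigOperators.Intervals
import Mathlib.Tactic
import HarnessLib

/-!
# Products of a periodic elliptic sequence over a half-system: `Π W(2k)³² = Π W(3k)¹² · Π W(k)²⁰`
# (a consequence of Ward's symmetry formula; proofs only)

Topic `NumberTheory/EllipticCurves`; companion of `EllipticNetPeriodic.lean` (Ward's symmetry
theorem `Literature.NumberTheory.EllipticCurves.EllipticNet.exists_periodic`: for an odd elliptic
net `W` over a field with rank of apparition `n`, `W(n + k) = α βᵏ W(k)` with `α² = βⁿ`).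
THEOREMS ONLY (no definition, no named fact, no instance).

Let `n = 2m + 1` be odd and let `W : ℤ → L` satisfy, for natural `r`,
`W(n + r) = α βʳ W(r)` and `βʳ W(n - r) = -α W(r)` (the symmetry formula and its reflection,
Silverman *AEC* Exercise 3.35(f)), with `α β ≠ 0`, `α² = βⁿ`. Over a field containing `θ` with
`θⁿ α = β^m` (e.g. an algebraic closure) the TWISTED sequence `V(k) = θ^{k²} W(k)` satisfies
`V(n + r) = V(r)` and `V(n - r)² = V(r)²` (`twist_add_period`, `twist_reflect_sq`), so `V(k)²` is a
function of `±k mod n`; hence for `a` prime to `n` the squares `V(ak)²`, `1 ≤ k ≤ m`, are a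
permutation of the `V(k)²` (`prod_twist_sq_mul_eq`), i.e.

  `θ^{2(a²-1)Σk²} · Π_{k=1}^{m} W(ak)² = Π_{k=1}^{m} W(k)²`.

Eliminating `θ` between `a = 2` and `a = 3` gives the `θ`-free identity of this file,

  **`(Π_{k=1}^{m} W(2k))³² = (Π_{k=1}^{m} W(3k))¹² · (Π_{k=1}^{m} W(k))²⁰`**  (`gcd(n, 6) = 1`)

(`prod_two_mul_pow_eq`), valid over the original field. For the division values `W(k) = ψ_k(P)`
of a point `P` of order `n` this is `(Π_{k ≤ m} ψ₂(kP)²)⁴ = (Π_{k ≤ m} (x(kP) - x(2kP)))¹²`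
(`ψ₂(kP) = ψ_{2k}/ψ_k⁴`, `x(kP) - x(2kP) = ψ_{3k}/(ψ_kψ_{2k}²)`), the cube step of Coates' lemma
`Δ(E)ⁿ/Δ(E/⟨P⟩) ∈ K^{×12}` in its Vélu form (file `VeluDiscriminantCoatesProofs`).

## References

* [SilvermanAEC2009] J. H. Silverman, *The Arithmetic of Elliptic Curves*, 2nd ed. (2009),
  Exercise 3.35(f) (the symmetry formula `W_{ri+j} = W_j A^{ij} B^{i²}`), Exercise 3.34.
* [Ward1948] M. Ward, *Memoir on elliptic divisibility sequences*, Amer. J. Math. 70 (1948),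
  Thm. 8.1–9.2 (symmetry), cited for provenance.
* [DokchitserDokchitser2015LocalInvariants] T. Dokchitser, V. Dokchitser, Trans. AMS 367 (2015),
  §2 Thm. 3 (Coates' lemma; the consumer).

## Design

Indices of the products are natural numbers (`Finset.Icc 1 m`), so that only natural powers of
`α, β, θ` occur; `W` itself is `ℤ`-indexed as in Mathlib's `IsEllipticNet`. The elliptic-net
relations are NOT used here — only the two displayed consequences of periodicity — so the file is
stated for an arbitrary sequence `W` with these two properties.
-/

open Finset

namespace Literature.NumberTheory.EllipticCurves

namespace EllipticNet

section Twist

variable {L : Type*} [Field L] {W : ℤ → L} {n m : ℕ} {α β θ : L}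

/-- **The twisted sequence is `n`-periodic**: with `V(k) = θ^{k²}W(k)`, `θⁿα = β^m`, `α² = βⁿ`,
`n = 2m + 1` and `W(n + r) = αβʳW(r)`: `V(n + r) = V(r)`, i.e.
`θ^{(n+r)²}·W(n + r) = θ^{r²}·W(r)`. (Consequence of the symmetry formula.)
[cite: SilvermanAEC2009, Exercise 3.35(f)] -/
theorem twist_add_period (hnm : n = 2 * m + 1) (hα : α ≠ 0) (hαβ : α ^ 2 = β ^ n)
    (hθ : θ ^ n * α = β ^ m) (hper : ∀ r : ℕ, W (n + r) = α * β ^ r * W r) (r : ℕ) :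
    θ ^ ((n + r) ^ 2) * W ((n + r : ℕ) : ℤ) = θ ^ (r ^ 2) * W r := by
  have key : θ ^ (n * (n + 2 * r)) * α * β ^ r = 1 := by
    have hαp : α ^ (n + 2 * r) ≠ 0 := pow_ne_zero _ hα
    apply mul_right_cancel₀ hαp
    have h1 : θ ^ (n * (n + 2 * r)) * α ^ (n + 2 * r) = β ^ (m * (n + 2 * r)) := by
      rw [pow_mul, ← mul_pow, hθ, ← pow_mul]
    have h2 : α ^ (n + 2 * r) = α * β ^ (n * (m + r)) := by
      rw [show n + 2 * r = 2 * (m + r) + 1 by omega, pow_succ, pow_mul, hαβ, ← pow_mul]; ring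
    calc θ ^ (n * (n + 2 * r)) * α * β ^ r * α ^ (n + 2 * r)
        = θ ^ (n * (n + 2 * r)) * α ^ (n + 2 * r) * (α * β ^ r) := by ring
      _ = β ^ (m * (n + 2 * r)) * (α * β ^ r) := by rw [h1]
      _ = α * β ^ (n * (m + r)) := by subst hnm; ring
      _ = 1 * α ^ (n + 2 * r) := by rw [h2, one_mul]
  rw [Nat.cast_add, hper r, show (n + r) ^ 2 = r ^ 2 + n * (n + 2 * r) by ring, pow_add]
  linear_combination θ ^ r ^ 2 * W r * key

/-- **Reflection of the twisted sequence**: with `βʳW(n - r) = -αW(r)` and `r ≤ n`,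
`V(n - r)² = V(r)²`, i.e. `θ^{2(n-r)²}·W(n - r)² = θ^{2r²}·W(r)²`.
(Consequence of the symmetry formula.) [cite: SilvermanAEC2009, Exercise 3.35(f)] -/
theorem twist_reflect_sq (hnm : n = 2 * m + 1) (hα : α ≠ 0) (hβ : β ≠ 0) (hαβ : α ^ 2 = β ^ n)
    (hθ : θ ^ n * α = β ^ m) (hrefl : ∀ r : ℕ, r ≤ n → β ^ r * W ((n : ℤ) - r) = -(α * W r))
    {r : ℕ} (hr : r ≤ n) :
    θ ^ (2 * (n - r) ^ 2) * W ((n : ℤ) - r) ^ 2 = θ ^ (2 * r ^ 2) * W r ^ 2 := by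
  -- it suffices to treat `2r ≤ n`; the other case is the same identity for `n - r`
  wlog h2r : 2 * r ≤ n generalizing r
  · have hr' : n - r ≤ n := Nat.sub_le n r
    have h2r' : 2 * (n - r) ≤ n := by omega
    have := this hr' h2r'
    rw [Nat.sub_sub_self hr, Nat.cast_sub hr, show (n : ℤ) - ((n : ℤ) - r) = r by ring] at this
    exact this.symm
  -- write `m = r + s`, `n - 2r = 2s + 1`
  obtain ⟨s, hs⟩ : ∃ s, m = r + s := ⟨m - r, by omega⟩
  have key : θ ^ (2 * (n * (n - 2 * r))) * α ^ 2 = β ^ (2 * r) := by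
    have hαp : α ^ (2 * (n - 2 * r)) ≠ 0 := pow_ne_zero _ hα
    apply mul_right_cancel₀ hαp
    have h1 : θ ^ (2 * (n * (n - 2 * r))) * α ^ (2 * (n - 2 * r)) = β ^ (2 * (m * (n - 2 * r))) := by
      rw [show 2 * (n * (n - 2 * r)) = n * (2 * (n - 2 * r)) by ring, pow_mul, ← mul_pow, hθ,
        ← pow_mul]
      ring
    have h2 : α ^ (2 * (n - 2 * r)) = β ^ (n * (n - 2 * r)) := by
      rw [pow_mul, hαβ, ← pow_mul]
    rw [mul_right_comm, h1, hαβ, mul_comm (β ^ (2 * r)), h2, ← pow_add, ← pow_add]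
    congr 1
    have : n - 2 * r = 2 * s + 1 := by omega
    rw [this]
    subst hs hnm
    ring
  have hβr : β ^ r ≠ 0 := pow_ne_zero _ hβ
  have h := hrefl r hr
  -- multiply the goal by `β^{2r}`
  apply mul_right_cancel₀ (pow_ne_zero 2 hβr)
  have e : (n - r) ^ 2 = r ^ 2 + n * (n - 2 * r) := by
    have : r ≤ n - r := by omega
    zify [hr, h2r]
    ring
  calc θ ^ (2 * (n - r) ^ 2) * W ((n : ℤ) - r) ^ 2 * (β ^ r) ^ 2
      = θ ^ (2 * (n - r) ^ 2) * (β ^ r * W ((n : ℤ) - r)) ^ 2 := by ring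
    _ = θ ^ (2 * r ^ 2) * (θ ^ (2 * (n * (n - 2 * r))) * α ^ 2) * W r ^ 2 := by
        rw [h, e, mul_add, pow_add]; ring
    _ = θ ^ (2 * r ^ 2) * W r ^ 2 * (β ^ r) ^ 2 := by rw [key]; ring

/-! ### Reduction of the twisted squares to the half-system `1 ≤ k ≤ m` -/

/-- `V(nq + r)² = V(r)²` for the twisted sequence (iterate `twist_add_period`).
[cite: SilvermanAEC2009, Exercise 3.35(f)] -/
theorem twist_sq_add_mul_period (hnm : n = 2 * m + 1) (hα : α ≠ 0) (hαβ : α ^ 2 = β ^ n)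
    (hθ : θ ^ n * α = β ^ m) (hper : ∀ r : ℕ, W (n + r) = α * β ^ r * W r) (q r : ℕ) :
    θ ^ (2 * (n * q + r) ^ 2) * W ((n * q + r : ℕ) : ℤ) ^ 2 = θ ^ (2 * r ^ 2) * W r ^ 2 := by
  induction q with
  | zero => simp
  | succ q ih =>
    have h := twist_add_period hnm hα hαβ hθ hper (n * q + r)
    have e : n * (q + 1) + r = n + (n * q + r) := by ring
    rw [e, show θ ^ (2 * (n + (n * q + r)) ^ 2) * W ((n + (n * q + r) : ℕ) : ℤ) ^ 2 =
      (θ ^ ((n + (n * q + r)) ^ 2) * W ((n + (n * q + r) : ℕ) : ℤ)) ^ 2 by ring, h, ← ih]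
    push_cast
    ring

/-- **`V(j)²` only depends on `±j mod n`**: for `j` not divisible by `n`, with
`ρ(j) = j mod n` if `j mod n ≤ m` and `ρ(j) = n - (j mod n)` otherwise (so `1 ≤ ρ(j) ≤ m`),
`V(j)² = V(ρ(j))²`. [cite: SilvermanAEC2009, Exercise 3.35(f)] -/
theorem twist_sq_eq_twist_sq_rho (hnm : n = 2 * m + 1) (hα : α ≠ 0) (hβ : β ≠ 0)
    (hαβ : α ^ 2 = β ^ n) (hθ : θ ^ n * α = β ^ m) (hper : ∀ r : ℕ, W (n + r) = α * β ^ r * W r)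
    (hrefl : ∀ r : ℕ, r ≤ n → β ^ r * W ((n : ℤ) - r) = -(α * W r)) (j : ℕ) :
    θ ^ (2 * j ^ 2) * W j ^ 2 =
      θ ^ (2 * (if j % n ≤ m then j % n else n - j % n) ^ 2) *
        W ((if j % n ≤ m then j % n else n - j % n : ℕ) : ℤ) ^ 2 := by
  have hmod := twist_sq_add_mul_period hnm hα hαβ hθ hper (j / n) (j % n)
  rw [Nat.div_add_mod j n] at hmod
  rw [hmod]
  split_ifs with hj
  · rfl
  · have hle : n - j % n ≤ n := Nat.sub_le _ _
    have h := twist_reflect_sq hnm hα hβ hαβ hθ hrefl hle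
    have hlt : j % n < n := Nat.mod_lt _ (by omega)
    rw [Nat.sub_sub_self hlt.le] at h
    rw [Nat.cast_sub hlt.le] at h ⊢
    rw [show (n : ℤ) - ((n : ℤ) - ((j % n : ℕ) : ℤ)) = ((j % n : ℕ) : ℤ) by ring] at h
    exact h

/-- The reduction map `k ↦ ρ(ak)` sends `[1, m]` to `[1, m]` when `a` is prime to `n = 2m + 1`.
Private plumbing. [folklore] -/
private theorem rho_mem_Icc (hnm : n = 2 * m + 1) {a : ℕ} (ha : a.Coprime n) {k : ℕ}
    (hk : k ∈ Icc 1 m) :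
    (if a * k % n ≤ m then a * k % n else n - a * k % n) ∈ Icc 1 m := by
  rw [mem_Icc] at hk ⊢
  have hn : 0 < n := by omega
  have hndvd : ¬ n ∣ a * k := by
    intro h
    have hk' : n ∣ k := (ha.symm.dvd_of_dvd_mul_left h)
    exact absurd (Nat.le_of_dvd (by omega) hk') (by omega)
  have hmod0 : a * k % n ≠ 0 := fun h => hndvd (Nat.dvd_of_mod_eq_zero h)
  have hlt : a * k % n < n := Nat.mod_lt _ hn
  split_ifs with h
  · exact ⟨Nat.pos_of_ne_zero hmod0, h⟩
  · constructor <;> omega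

/-- The reduction map `k ↦ ρ(ak)` is injective on `[1, m]` when `a` is prime to `n = 2m + 1`
(`ak ≡ ±ak'` forces `k ≡ ±k'`, and `0 < k + k' < n`). Private plumbing. [folklore] -/
private theorem rho_injOn (hnm : n = 2 * m + 1) {a : ℕ} (ha : a.Coprime n) :
    Set.InjOn (fun k : ℕ => if a * k % n ≤ m then a * k % n else n - a * k % n)
      (Icc 1 m : Finset ℕ) := by
  intro k hk k' hk' h
  simp only [coe_Icc, Set.mem_Icc] at hk hk'
  simp only at h
  have hn : 0 < n := by omega
  have hlt : a * k % n < n := Nat.mod_lt _ hn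
  have hlt' : a * k' % n < n := Nat.mod_lt _ hn
  -- the two possible congruences
  have same : a * k % n = a * k' % n → k = k' := by
    intro hmm
    have h1 : a * k ≡ a * k' [MOD n] := hmm
    have h2 : k ≡ k' [MOD n] := Nat.ModEq.cancel_left_of_coprime (by simpa using ha.symm) h1
    exact Nat.ModEq.eq_of_lt_of_lt h2 (by omega) (by omega)
  have opp : a * k % n + a * k' % n = n → False := by
    intro hsum
    have h1 : a * (k + k') ≡ 0 [MOD n] := by
      rw [mul_add, Nat.ModEq, Nat.add_mod, hsum, Nat.mod_self, Nat.zero_mod]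
    have h2 : n ∣ a * (k + k') := (Nat.modEq_zero_iff_dvd.mp h1)
    have h3 : n ∣ k + k' := ha.symm.dvd_of_dvd_mul_left h2
    exact absurd (Nat.le_of_dvd (by omega) h3) (by omega)
  split_ifs at h with h₁ h₂ h₂
  · exact same h
  · exact (opp (by omega)).elim
  · exact (opp (by omega)).elim
  · exact same (by omega)

/-- **The twisted squares over `a·[1, m]` are a permutation of those over `[1, m]`** (`a` prime to
`n = 2m + 1`): `Π_{k=1}^{m} θ^{2(ak)²} W(ak)² = Π_{k=1}^{m} θ^{2k²} W(k)²`.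
[cite: SilvermanAEC2009, Exercise 3.35(f)] -/
theorem prod_twist_sq_mul_eq (hnm : n = 2 * m + 1) (hα : α ≠ 0) (hβ : β ≠ 0)
    (hαβ : α ^ 2 = β ^ n) (hθ : θ ^ n * α = β ^ m) (hper : ∀ r : ℕ, W (n + r) = α * β ^ r * W r)
    (hrefl : ∀ r : ℕ, r ≤ n → β ^ r * W ((n : ℤ) - r) = -(α * W r)) {a : ℕ} (ha : a.Coprime n) :
    ∏ k ∈ Icc 1 m, θ ^ (2 * (a * k) ^ 2) * W ((a * k : ℕ) : ℤ) ^ 2 =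
      ∏ k ∈ Icc 1 m, θ ^ (2 * k ^ 2) * W k ^ 2 := by
  set ρ : ℕ → ℕ := fun k => if a * k % n ≤ m then a * k % n else n - a * k % n with hρ
  have hmaps : ∀ k ∈ Icc 1 m, ρ k ∈ Icc 1 m := fun k hk => rho_mem_Icc hnm ha hk
  have hinj : Set.InjOn ρ (Icc 1 m : Finset ℕ) := rho_injOn hnm ha
  have hsurj : Set.SurjOn ρ (Icc 1 m : Finset ℕ) (Icc 1 m : Finset ℕ) := by
    intro b hb
    obtain ⟨k, hk, hkb⟩ := surj_on_of_inj_on_of_card_le (s := Icc 1 m) (t := Icc 1 m)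
      (fun k _ => ρ k) (fun k hk => hmaps k hk) (fun k₁ k₂ h₁ h₂ h => hinj h₁ h₂ h) le_rfl b hb
    exact ⟨k, hk, hkb.symm⟩
  refine prod_nbij ρ hmaps hinj hsurj fun k _ => ?_
  exact twist_sq_eq_twist_sq_rho hnm hα hβ hαβ hθ hper hrefl (a * k)

/-! ### Elimination of `θ`: the product identity over the original field -/

/-- **`(Π_{k=1}^{m} W(2k))³² = (Π_{k=1}^{m} W(3k))¹² · (Π_{k=1}^{m} W(k))²⁰`** for a sequence
`W` with `W(n + r) = αβʳW(r)`, `βʳW(n - r) = -αW(r)` (`r ∈ ℕ`), `α² = βⁿ`, `n = 2m + 1` prime to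
`6`, over a field containing `θ` with `θⁿα = β^m` (e.g. algebraically closed). (From
`prod_twist_sq_mul_eq` for `a = 2, 3`: `Θ⁴·Π W(2k)² = Θ·Π W(k)²`, `Θ⁹·Π W(3k)² = Θ·Π W(k)²` with
`Θ = Π θ^{2k²}`.) [cite: SilvermanAEC2009, Exercise 3.35(f)] -/
theorem prod_two_mul_pow_eq_of_root (hnm : n = 2 * m + 1) (hα : α ≠ 0) (hβ : β ≠ 0)
    (hαβ : α ^ 2 = β ^ n) (hθ : θ ^ n * α = β ^ m) (hper : ∀ r : ℕ, W (n + r) = α * β ^ r * W r)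
    (hrefl : ∀ r : ℕ, r ≤ n → β ^ r * W ((n : ℤ) - r) = -(α * W r)) (h2 : Nat.Coprime 2 n)
    (h3 : Nat.Coprime 3 n) :
    (∏ k ∈ Icc 1 m, W ((2 * k : ℕ) : ℤ)) ^ 32 =
      (∏ k ∈ Icc 1 m, W ((3 * k : ℕ) : ℤ)) ^ 12 * (∏ k ∈ Icc 1 m, W k) ^ 20 := by
  have hθ0 : θ ≠ 0 := by
    rintro rfl
    have hn : n ≠ 0 := by omega
    rw [zero_pow hn, zero_mul] at hθ
    exact pow_ne_zero m hβ hθ.symm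
  set Θ := ∏ k ∈ Icc 1 m, θ ^ (2 * k ^ 2) with hΘ
  have hΘ0 : Θ ≠ 0 := prod_ne_zero_iff.mpr fun k _ => pow_ne_zero _ hθ0
  have split : ∀ a : ℕ, ∏ k ∈ Icc 1 m, θ ^ (2 * (a * k) ^ 2) * W ((a * k : ℕ) : ℤ) ^ 2 =
      Θ ^ (a ^ 2) * (∏ k ∈ Icc 1 m, W ((a * k : ℕ) : ℤ)) ^ 2 := by
    intro a
    rw [prod_mul_distrib, hΘ, ← prod_pow, ← prod_pow]
    congr 1
    exact prod_congr rfl fun k _ => by rw [← pow_mul]; ring_nf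
  have hA := prod_twist_sq_mul_eq hnm hα hβ hαβ hθ hper hrefl h2
  have hB := prod_twist_sq_mul_eq hnm hα hβ hαβ hθ hper hrefl h3
  have h1 : ∏ k ∈ Icc 1 m, θ ^ (2 * k ^ 2) * W k ^ 2 = Θ * (∏ k ∈ Icc 1 m, W k) ^ 2 := by
    rw [prod_mul_distrib, hΘ, ← prod_pow]
  rw [split, h1] at hA hB
  set A := ∏ k ∈ Icc 1 m, W ((2 * k : ℕ) : ℤ)
  set B := ∏ k ∈ Icc 1 m, W ((3 * k : ℕ) : ℤ)
  set P := ∏ k ∈ Icc 1 m, W k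
  -- `A²Θ³ = P²`, `B²Θ⁸ = P²`
  have hA' : A ^ 2 * Θ ^ 3 = P ^ 2 := by
    apply mul_left_cancel₀ hΘ0
    linear_combination hA
  have hB' : B ^ 2 * Θ ^ 8 = P ^ 2 := by
    apply mul_left_cancel₀ hΘ0
    linear_combination hB
  apply mul_right_cancel₀ (pow_ne_zero 48 hΘ0)
  calc A ^ 32 * Θ ^ 48 = (A ^ 2 * Θ ^ 3) ^ 16 := by ring
    _ = (P ^ 2) ^ 16 := by rw [hA']
    _ = (B ^ 2 * Θ ^ 8) ^ 6 * (P ^ 2) ^ 10 := by rw [hB']; ring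
    _ = B ^ 12 * P ^ 20 * Θ ^ 48 := by ring

end Twist

end EllipticNet

end Literature.NumberTheory.EllipticCurves
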